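import Mathlib
import Summits.QuantumFields.BalabanUV.Beta.UnitLatticeDecoratedChains

/-!
# `Summit.QuantumFields.BalabanUV.Beta.UnitLatticeDecoratedResolvent` — A3-loc (iv)-assembly: the s-DECORATED truncated
# walk expansion `decSum m = Σ_{n<m} Σ_{b⃗} (Π_{Δ∈dec(b⃗)} s(Δ))·walkTerm n b⃗` is bounded on the polydisc `‖s(Δ)‖ ≤ e^{κ₁}`
# by `e^{κ₁c₀}·N·C_L·Σ_{n<m} ρ′ⁿ`, `ρ′` the spine's ratio at the rate `κ + κ₁c₁/M_d`, GIVEN the tube property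
# `#dec(b⃗) ≤ c₀ + c₁·sepSum(b⃗)/M_d`; at `s ≡ 1` it is the truncated inverse `Σ_{n<m} Ptot·Remⁿ`

HONEST FRAMING (page 1 of everything in this cell).  Discharging `FlowStep.BetaPertH` would make
Bałaban's ultraviolet stability UNCONDITIONAL — a constructive-QFT result; it is NOT the continuum
limit and NOT the Clay problem.  This module discharges nothing of `BetaPertH`; [folklore] algebra, kernel-checked (unit
`b2b-balaban-beta-d4-p3`, road P3, gen 3; leaf A3-loc (iv) of skeleton v1.7 §7.4 — the assembly over
`UnitLatticeDecoratedChains.wrs_decoratedSum`, with the TUBE COUNT (iii) as an explicit hypothesis-shape).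
HONEST DEPENDENCY: continuum YM on T⁴ ⇐ BetaPertH ∧ nine spine estimates (0/9 proved); BetaPertH ⇐
(D1) ∧ (D4) ∧ CAP+tail; G-an2-4 gates asym, D1 and NE2/3/4.

CONTENTS (0 sorry): `decCoeff` (the s-monomial of a decorated term), `norm_decCoeff_le` (≤ `e^{κ₁·#dec}`),
`norm_decCoeff_le_of_tube` (≤ `e^{κ₁c₀}·e^{(κ₁c₁/M_d)·sepSum}` under the tube property), `decSum`, **`wrs_decSum`** (the
polydisc bound), `decSum_one` (at `s ≡ 1`: `Σ_{n<m} Ptot·Remⁿ` — `UnitLatticeWalkTerms.Ptot_mul_Rem_pow` BY NAME).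
NOT HERE: the tube count itself (geometry of the decoration cubes, A3-loc (iii)), the recombination (v), any instance.
-/

open scoped BigOperators Matrix
open Finset Matrix

namespace Summit.QuantumFields.BalabanUV.Beta.UnitLatticeDecoratedResolvent

open Summit.QuantumFields.BalabanUV.Beta.UnitLatticeWalkInversion
open Summit.QuantumFields.BalabanUV.Beta.UnitLatticeWalkTerms
open Summit.QuantumFields.BalabanUV.Beta.UnitLatticeDecoratedChains
open Literature.MathematicalPhysics.QuantumFieldTheory.Balaban1983to89.B13PerturbativeStep (wrs WRS WeightHyp)

noncomputable section

variable {Y : Type*} [Fintype Y] [DecidableEq Y] {B Δ : Type*}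

/-- The s-MONOMIAL of a decorated walk term: `Π_{Δ ∈ dec(b⃗)} s(Δ)`. [folklore] -/
def decCoeff (s : Δ → ℂ) (dec : (n : ℕ) → (Fin (n + 1) → B) → Finset Δ) (n : ℕ) (b : Fin (n + 1) → B) : ℂ :=
  ∏ δ ∈ dec n b, s δ

omit [Fintype Y] [DecidableEq Y] in
/-- On the polydisc `‖s(Δ)‖ ≤ e^{κ₁}`: `‖decCoeff‖ ≤ e^{κ₁·#dec(b⃗)}`. [folklore] -/
theorem norm_decCoeff_le (s : Δ → ℂ) (dec : (n : ℕ) → (Fin (n + 1) → B) → Finset Δ) {κ₁ : ℝ}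
    (hs : ∀ δ, ‖s δ‖ ≤ Real.exp κ₁) (n : ℕ) (b : Fin (n + 1) → B) :
    ‖decCoeff s dec n b‖ ≤ Real.exp (κ₁ * ((dec n b).card : ℝ)) := by
  rw [decCoeff, norm_prod]
  calc ∏ δ ∈ dec n b, ‖s δ‖ ≤ ∏ _δ ∈ dec n b, Real.exp κ₁ :=
        Finset.prod_le_prod (fun δ _ => norm_nonneg _) (fun δ _ => hs δ)
    _ = Real.exp κ₁ ^ (dec n b).card := Finset.prod_const _
    _ = Real.exp (κ₁ * ((dec n b).card : ℝ)) := by rw [mul_comm, Real.exp_nat_mul]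

omit [Fintype Y] [DecidableEq Y] in
/-- Under the TUBE PROPERTY `#dec(b⃗) ≤ c₀ + c₁·sepSum(b⃗)/M_d` (`κ₁ ≥ 0`):
`‖decCoeff‖ ≤ e^{κ₁c₀}·e^{(κ₁c₁/M_d)·sepSum(b⃗)}`. [folklore] -/
theorem norm_decCoeff_le_of_tube (s : Δ → ℂ) (dec : (n : ℕ) → (Fin (n + 1) → B) → Finset Δ) {κ₁ c₀ c₁ Md : ℝ}
    (hκ₁ : 0 ≤ κ₁) (hs : ∀ δ, ‖s δ‖ ≤ Real.exp κ₁) (sep : B → B → ℝ)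
    (htube : ∀ (n : ℕ) (b : Fin (n + 1) → B), ((dec n b).card : ℝ) ≤ c₀ + c₁ * sepSum sep n b / Md)
    (n : ℕ) (b : Fin (n + 1) → B) :
    ‖decCoeff s dec n b‖ ≤ Real.exp (κ₁ * c₀) * Real.exp (κ₁ * c₁ / Md * sepSum sep n b) := by
  refine (norm_decCoeff_le s dec hs n b).trans ?_
  rw [← Real.exp_add]
  exact Real.exp_le_exp.2 (by
    have := mul_le_mul_of_nonneg_left (htube n b) hκ₁
    calc κ₁ * ((dec n b).card : ℝ) ≤ κ₁ * (c₀ + c₁ * sepSum sep n b / Md) := this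
      _ = κ₁ * c₀ + κ₁ * c₁ / Md * sepSum sep n b := by ring)

/-- The s-DECORATED truncated walk expansion `Σ_{n<m} Σ_{b⃗} decCoeff(b⃗)·walkTerm n b⃗`. [folklore] -/
def decSum [Fintype B] (h : B → Y → ℝ) (K' : Matrix Y Y ℂ) (L : B → Matrix Y Y ℂ) (s : Δ → ℂ)
    (dec : (n : ℕ) → (Fin (n + 1) → B) → Finset Δ) (m : ℕ) : Matrix Y Y ℂ :=
  ∑ n ∈ Finset.range m, ∑ b : Fin (n + 1) → B, decCoeff s dec n b • walkTerm h K' L n b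

/-- **THE POLYDISC BOUND.**  Partition data (support, `|h| ≤ 1`, Lipschitz `1/M`, overlap `N`), local inverses
(`P_□L_□ = L_□`, budget `C_L`), separation `sep` compatible with `d` on the cubes, `κ₁ ≥ 0`, the tube property with
constants `c₀, c₁ ≥ 0`, `M_d > 0`, and the first exponential moment `K₁′` of `K′` at the rate `κ + κ₁c₁/M_d`.  Then on
`‖s(Δ)‖ ≤ e^{κ₁}`: `WRS κ d (decSum m) (e^{κ₁c₀}·(N·C_L)·Σ_{n<m} ((2N/M)·C_L·K₁′)ⁿ)`. [folklore] -/
theorem wrs_decSum [Fintype B] {κ : ℝ} {d : Y → Y → ℝ} (hw : WeightHyp κ d) (K' : Matrix Y Y ℂ) (h : B → Y → ℝ)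
    (E : B → Finset Y) (L : B → Matrix Y Y ℂ) (hsupp : ∀ b y, y ∉ E b → h b y = 0) (habs : ∀ b y, |h b y| ≤ 1)
    (hPL : ∀ b, Pj E b * L b = L b) {M N C_L K₁ κ₁ c₀ c₁ Md : ℝ} (hM : 0 < M)
    (hLip : ∀ b y y', |h b y - h b y'| ≤ d y y' / M) (hN : ∀ y, ((Finset.univ.filter fun b => y ∈ E b).card : ℝ) ≤ N)
    (hC : 0 ≤ C_L) (hL : ∀ b, WRS κ d (L b) C_L) (hκ₁ : 0 ≤ κ₁) (hc₁ : 0 ≤ c₁) (hMd : 0 < Md)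
    (hK₁ : ∀ i, ∑ j, ‖K' i j‖ * d i j * Real.exp ((κ + κ₁ * c₁ / Md) * d i j) ≤ K₁)
    (sep : B → B → ℝ) (hsep0 : ∀ b b', 0 ≤ sep b b') (hsep : ∀ b b' k l, k ∈ E b → l ∈ E b' → sep b b' ≤ d k l)
    (s : Δ → ℂ) (hs : ∀ δ, ‖s δ‖ ≤ Real.exp κ₁) (dec : (n : ℕ) → (Fin (n + 1) → B) → Finset Δ)
    (htube : ∀ (n : ℕ) (b : Fin (n + 1) → B), ((dec n b).card : ℝ) ≤ c₀ + c₁ * sepSum sep n b / Md) (m : ℕ) :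
    WRS κ d (decSum h K' L s dec m)
      (Real.exp (κ₁ * c₀) * (N * C_L) * ∑ n ∈ Finset.range m, (2 * N / M * C_L * K₁) ^ n) := by
  intro i
  rw [decSum, Finset.mul_sum]
  refine (wrs_sum_le _ _ i).trans (Finset.sum_le_sum fun n _ => ?_)
  have hδ : 0 ≤ κ₁ * c₁ / Md := div_nonneg (mul_nonneg hκ₁ hc₁) hMd.le
  exact wrs_decoratedSum hw K' h E L hsupp habs hPL hM hLip hN hC hL hδ (Real.exp_pos _).le hK₁ sep hsep0 hsep n
    (decCoeff s dec n) (fun b => norm_decCoeff_le_of_tube s dec hκ₁ hs sep htube n b) i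

/-- **At `s ≡ 1` the decorated sum is the truncated inverse**: `decSum m = Σ_{n<m} Ptot·Remⁿ`
(`UnitLatticeWalkTerms.Ptot_mul_Rem_pow` BY NAME). [folklore] -/
theorem decSum_one [Fintype B] (h : B → Y → ℝ) (K' : Matrix Y Y ℂ) (L : B → Matrix Y Y ℂ)
    (dec : (n : ℕ) → (Fin (n + 1) → B) → Finset Δ) (m : ℕ) :
    decSum h K' L (fun _ => (1 : ℂ)) dec m = ∑ n ∈ Finset.range m, Ptot h L * Rem h K' L ^ n := by
  rw [decSum]
  refine Finset.sum_congr rfl fun n _ => ?_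
  rw [Ptot_mul_Rem_pow]
  refine Finset.sum_congr rfl fun b _ => ?_
  rw [decCoeff, Finset.prod_const_one, one_smul]

end

end Summit.QuantumFields.BalabanUV.Beta.UnitLatticeDecoratedResolvent
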